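import Summits.Ventures.PercRepro.C041TriDomStockedHost
import Summits.Ventures.PercRepro.C041TriDomDominationAnchored

/-!
# ROW C-041 — THE REDUCTIONS FOR THE ANCHORED ORIENTATION
(p6, gen 46; P6-TWOEXIT-LEAN.md §53 ADDENDUM 18)

The cell's second orientation (ADDENDUM 15 cont. 2): the anchored crossed classes `(s₁,s₂) ∪ (s₂,s₃) ∪ (s₁,s₃)`
(`AncCrossed` on the all-free host) against `(⊤, ⊥)`.  On a STATUS: `AncCrossedS`, `AncDominationS` (the all-free
status is the landed `AncDomination`, `ancDominationS_free`).  The generic counts of this gen are blind to the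
orientation — they only need the classes to be built from the six connectivities among the marks — so the four
reductions hold for the anchored conjecture verbatim: the two-exit piece (`ancDominationS_of_twoExit`), the redundant
edge (`ancDominationS_of_redundant`), the parallel pair (`ancDominationS_of_parallel`) and the 2-cut gluing
(`ancDominationS_of_twoCut`).  What the anchored orientation still lacks is its CUT-VERTEX family (the analogue of the
sibling, ADDENDUM 16 cont.: five statements at the pattern level), so no induction is stated here.
-/

namespace PercRepro

namespace ZoneZ

namespace MultiExit

open ZoneData Finset Classical

variable {V₁ E₁ U₁ U₂ : Type} (Z₁ : ZoneData V₁ E₁ U₁ U₂) (x y z : V₁)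

/-- The anchored crossed classes `(s₁,s₂) ∪ (s₂,s₃) ∪ (s₁,s₃)` of the host under a status (anchor `x`, exits `y, z`). -/
def AncCrossedS (st : E₁ → EStat) (ω : E₁ → Bool) : Prop :=
  (rsig Z₁ y z x st ω = (true, false, false) ∧ bsig Z₁ y z x st ω = (false, true, false)) ∨
    (rsig Z₁ y z x st ω = (false, true, false) ∧ bsig Z₁ y z x st ω = (false, false, true)) ∨
    (rsig Z₁ y z x st ω = (true, false, false) ∧ bsig Z₁ y z x st ω = (false, false, true))

/-- The anchored classes of the all-free status are the landed ones. -/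
theorem ancCrossedS_free : AncCrossedS Z₁ x y z (fun _ => EStat.free) = AncCrossed Z₁ y z x := rfl

/-- The anchored classes under a status, in the twelve connectivities. -/
theorem ancCrossedS_iff (st : E₁ → EStat) (ω : E₁ → Bool) : AncCrossedS Z₁ x y z st ω ↔
    ((RdS Z₁ st ω x y ∧ ¬ RdS Z₁ st ω x z ∧ ¬ RdS Z₁ st ω y z) ∧
        (¬ MgS Z₁ st ω x y ∧ MgS Z₁ st ω x z ∧ ¬ MgS Z₁ st ω y z)) ∨
      ((¬ RdS Z₁ st ω x y ∧ RdS Z₁ st ω x z ∧ ¬ RdS Z₁ st ω y z) ∧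
        (¬ MgS Z₁ st ω x y ∧ ¬ MgS Z₁ st ω x z ∧ MgS Z₁ st ω y z)) ∨
      ((RdS Z₁ st ω x y ∧ ¬ RdS Z₁ st ω x z ∧ ¬ RdS Z₁ st ω y z) ∧
        (¬ MgS Z₁ st ω x y ∧ ¬ MgS Z₁ st ω x z ∧ MgS Z₁ st ω y z)) := by
  unfold AncCrossedS
  simp only [rsigS_eq_iff, bsigS_eq_iff, iff_true, Bool.false_eq_true, iff_false]

section Counting

variable [Fintype E₁] [DecidableEq E₁]

/-- The anchored conjecture on a status: on every up-set the anchored classes are outnumbered by `(⊤, ⊥)`. -/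
def AncDominationS (st : E₁ → EStat) : Prop :=
  ∀ V : (E₁ → Bool) → Prop, UpSet V →
    (univ.filter fun ω : E₁ → Bool => V ω ∧ AncCrossedS Z₁ x y z st ω).card ≤
      (univ.filter fun ω : E₁ → Bool => V ω ∧ TopBotS Z₁ x y z st ω).card

/-- On the all-free status the status form is the landed anchored conjecture. -/
theorem ancDominationS_free : AncDominationS Z₁ x y z (fun _ => EStat.free) ↔ AncDomination Z₁ y z x := Iff.rfl

variable {x y z} {st : E₁ → EStat}

/-- **THE TWO-EXIT PIECE** for the anchored conjecture. -/
theorem ancDominationS_of_twoExit {K : Set V₁} {u v : V₁} {f₁ f₂ : E₁} (hT : TwoExit Z₁ st K u v f₁ f₂)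
    (hx : x ∉ K) (hy : y ∉ K) (hz : z ∉ K) (h₀ : AncDominationS Z₁ x y z (stDel st f₁ f₂))
    (h₁ : AncDominationS Z₁ x y z (stCon st f₁)) : AncDominationS Z₁ x y z st := by
  intro V hV
  have key := dom_of_twoExit_count hT.hne (Src := AncCrossedS Z₁ x y z) (Tgt := TopBotS Z₁ x y z)
    (st := st) (st₀ := stDel st f₁ f₂) (st₁ := stCon st f₁)
    (fun ω h => by
      rw [ancCrossedS_iff, ancCrossedS_iff, topBotS_iff, topBotS_iff, RdS_stCon_iff Z₁ hT ω h hx hy,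
        RdS_stCon_iff Z₁ hT ω h hx hz, RdS_stCon_iff Z₁ hT ω h hy hz, MgS_stCon_iff Z₁ hT ω h hx hy,
        MgS_stCon_iff Z₁ hT ω h hx hz, MgS_stCon_iff Z₁ hT ω h hy hz]
      exact ⟨Iff.rfl, Iff.rfl⟩)
    (fun ω h => by
      rw [ancCrossedS_iff, ancCrossedS_iff, topBotS_iff, topBotS_iff, RdS_stDel_iff Z₁ hT ω h hx hy,
        RdS_stDel_iff Z₁ hT ω h hx hz, RdS_stDel_iff Z₁ hT ω h hy hz, MgS_stDel_iff Z₁ hT ω h hx hy,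
        MgS_stDel_iff Z₁ hT ω h hx hz, MgS_stDel_iff Z₁ hT ω h hy hz]
      exact ⟨Iff.rfl, Iff.rfl⟩)
    (fun ω ω' h => by
      rw [ancCrossedS_iff, ancCrossedS_iff, topBotS_iff, topBotS_iff, RdS_stCon_congr Z₁ h, MgS_stCon_congr Z₁ h]
      exact ⟨Iff.rfl, Iff.rfl⟩)
    (fun ω ω' h => by
      rw [ancCrossedS_iff, ancCrossedS_iff, topBotS_iff, topBotS_iff, RdS_stDel_congr Z₁ h, MgS_stDel_congr Z₁ h]
      exact ⟨Iff.rfl, Iff.rfl⟩)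
    (fun V hV => (card_filter_inst.trans_le (h₀ V hV)).trans_eq card_filter_inst)
    (fun V hV => (card_filter_inst.trans_le (h₁ V hV)).trans_eq card_filter_inst) V hV
  exact (card_filter_inst.trans_le key).trans_eq card_filter_inst

/-- **THE REDUNDANT EDGE** for the anchored conjecture. -/
theorem ancDominationS_of_redundant {f : E₁} {a b : V₁} (hf : st f = EStat.free) (hj : Z₁.Joins f a b)
    (hab : DConn Z₁ st a b) (h : AncDominationS Z₁ x y z (stAbs st f)) : AncDominationS Z₁ x y z st := by
  intro V hV
  have hc : ∀ ω, (AncCrossedS Z₁ x y z st ω ↔ AncCrossedS Z₁ x y z (stAbs st f) ω) ∧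
      (TopBotS Z₁ x y z st ω ↔ TopBotS Z₁ x y z (stAbs st f) ω) := by
    intro ω
    rw [ancCrossedS_iff, ancCrossedS_iff, topBotS_iff, topBotS_iff, RdS_stAbs_eq_of_dconn Z₁ hf hj hab ω,
      MgS_stAbs_eq_of_dconn Z₁ hf hj hab ω]
    exact ⟨Iff.rfl, Iff.rfl⟩
  exact (card_filter_congr' fun ω _ => and_congr_right fun _ => (hc ω).1).trans_le
    ((h V hV).trans_eq (card_filter_congr' fun ω _ => and_congr_right fun _ => (hc ω).2.symm))

/-- **THE PARALLEL PAIR** for the anchored conjecture. -/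
theorem ancDominationS_of_parallel {f₁ f₁' : E₁} {a b a' b' : V₁} (hP : Parallel Z₁ st f₁ f₁' a b a' b')
    (h₀ : AncDominationS Z₁ x y z (stAbs (stCon st f₁) f₁')) (h₁ : AncDominationS Z₁ x y z (stAbs st f₁)) :
    AncDominationS Z₁ x y z st := by
  intro V hV
  have key := dom_of_twoExit_count hP.hne (Src := AncCrossedS Z₁ x y z) (Tgt := TopBotS Z₁ x y z)
    (st := st) (st₀ := stAbs (stCon st f₁) f₁') (st₁ := stAbs st f₁)
    (fun ω h => by
      rw [ancCrossedS_iff, ancCrossedS_iff, topBotS_iff, topBotS_iff, RdS_parallel_same Z₁ hP ω h,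
        MgS_parallel_same Z₁ hP ω h]
      exact ⟨Iff.rfl, Iff.rfl⟩)
    (fun ω h => by
      rw [ancCrossedS_iff, ancCrossedS_iff, topBotS_iff, topBotS_iff, RdS_parallel_diff Z₁ hP ω h,
        MgS_parallel_diff Z₁ hP ω h]
      exact ⟨Iff.rfl, Iff.rfl⟩)
    (fun ω ω' h => by
      rw [ancCrossedS_iff, ancCrossedS_iff, topBotS_iff, topBotS_iff, RdS_stAbs_congr Z₁ h, MgS_stAbs_congr Z₁ h]
      exact ⟨Iff.rfl, Iff.rfl⟩)
    (fun ω ω' h => by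
      rw [ancCrossedS_iff, ancCrossedS_iff, topBotS_iff, topBotS_iff, RdS_stAbsCon_congr Z₁ h,
        MgS_stAbsCon_congr Z₁ h]
      exact ⟨Iff.rfl, Iff.rfl⟩)
    (fun V hV => (card_filter_inst.trans_le (h₀ V hV)).trans_eq card_filter_inst)
    (fun V hV => (card_filter_inst.trans_le (h₁ V hV)).trans_eq card_filter_inst) V hV
  exact (card_filter_inst.trans_le key).trans_eq card_filter_inst

/-- The anchored classes of `st` are cut-related to those of the three chord statuses. -/
theorem ancCrossed_cutRel {u v w : V₁} {c₀ : E₁} (hwu : w ≠ u) (hwv : w ≠ v) (hc₀ : st c₀ = EStat.absent)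
    (hc : Z₁.Joins c₀ u v) (hx : x ∉ side2 Z₁ st u v w) (hy : y ∉ side2 Z₁ st u v w) (hz : z ∉ side2 Z₁ st u v w) :
    CutRel (InC2S Z₁ st u v w) c₀ (fun i => RdS Z₁ (stIn2S Z₁ st u v w) i u v)
      (fun i => MgS Z₁ (stIn2S Z₁ st u v w) i u v) (AncCrossedS Z₁ x y z st)
      (AncCrossedS Z₁ x y z (stOut2S Z₁ st u v w)) (AncCrossedS Z₁ x y z (stDbl Z₁ st u v w c₀))
      (AncCrossedS Z₁ x y z (stChord Z₁ st u v w c₀)) where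
  hN o i _ _ hr hb := by
    rw [ancCrossedS_iff, ancCrossedS_iff, (conn_N Z₁ hwu hwv o i hr hb hx hy).1, (conn_N Z₁ hwu hwv o i hr hb hx hz).1,
      (conn_N Z₁ hwu hwv o i hr hb hy hz).1, (conn_N Z₁ hwu hwv o i hr hb hx hy).2, (conn_N Z₁ hwu hwv o i hr hb hx hz).2,
      (conn_N Z₁ hwu hwv o i hr hb hy hz).2]
  hD o i _ _ hr hb := by
    rw [ancCrossedS_iff, ancCrossedS_iff, (conn_D Z₁ hwu hwv hc₀ hc o i hr hb hx hy).1,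
      (conn_D Z₁ hwu hwv hc₀ hc o i hr hb hx hz).1, (conn_D Z₁ hwu hwv hc₀ hc o i hr hb hy hz).1,
      (conn_D Z₁ hwu hwv hc₀ hc o i hr hb hx hy).2, (conn_D Z₁ hwu hwv hc₀ hc o i hr hb hx hz).2,
      (conn_D Z₁ hwu hwv hc₀ hc o i hr hb hy hz).2]
  hC o i _ _ hrb := by
    rw [ancCrossedS_iff, ancCrossedS_iff, (conn_C Z₁ hwu hwv hc₀ hc o i hrb hx hy).1,
      (conn_C Z₁ hwu hwv hc₀ hc o i hrb hx hz).1, (conn_C Z₁ hwu hwv hc₀ hc o i hrb hy hz).1,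
      (conn_C Z₁ hwu hwv hc₀ hc o i hrb hx hy).2, (conn_C Z₁ hwu hwv hc₀ hc o i hrb hx hz).2,
      (conn_C Z₁ hwu hwv hc₀ hc o i hrb hy hz).2]
  hout ω := by
    refine ⟨?_, ?_, ?_⟩
    · rw [ancCrossedS_iff, ancCrossedS_iff, RdS_stOut2S_congr_out Z₁ (outN_agree_out Z₁ ω),
        MgS_stOut2S_congr_out Z₁ (outN_agree_out Z₁ ω)]
    · rw [ancCrossedS_iff, ancCrossedS_iff, RdS_stDbl_congr_out Z₁ (outN_agree_out Z₁ ω),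
        MgS_stDbl_congr_out Z₁ (outN_agree_out Z₁ ω)]
    · rw [ancCrossedS_iff, ancCrossedS_iff, RdS_stChord_congr_out Z₁ hwu hwv hc (outN_agree_out Z₁ ω),
        MgS_stChord_congr_out Z₁ hwu hwv hc (outN_agree_out Z₁ ω)]

/-- **THE 2-CUT GLUING** for the anchored conjecture. -/
theorem ancDominationS_of_twoCut {u v w : V₁} {c₀ : E₁} (hwu : w ≠ u) (hwv : w ≠ v) (hc₀ : st c₀ = EStat.absent)
    (hc : Z₁.Joins c₀ u v) (hx : x ∉ side2 Z₁ st u v w) (hy : y ∉ side2 Z₁ st u v w) (hz : z ∉ side2 Z₁ st u v w)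
    (hN : AncDominationS Z₁ x y z (stOut2S Z₁ st u v w)) (hD : AncDominationS Z₁ x y z (stDbl Z₁ st u v w c₀))
    (hC : AncDominationS Z₁ x y z (stChord Z₁ st u v w c₀)) : AncDominationS Z₁ x y z st := by
  intro V hV
  obtain ⟨ψ, hinj, hψ⟩ := exists_transport2 Z₁ (st := st) (u := u) (v := v) (w := w)
  have key := dom_of_twoCut_count (not_InC2S_chord Z₁ hwu hwv hc)
    (ancCrossed_cutRel Z₁ hwu hwv hc₀ hc hx hy hz) (topBot_cutRel Z₁ hwu hwv hc₀ hc x y z hx hy hz)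
    (fun V hV => (card_filter_inst.trans_le (hN V hV)).trans_eq card_filter_inst)
    (fun V hV => (card_filter_inst.trans_le (hD V hV)).trans_eq card_filter_inst)
    (fun V hV => (card_filter_inst.trans_le (hC V hV)).trans_eq card_filter_inst) ψ hψ hinj V hV
  exact (card_filter_inst.trans_le key).trans_eq card_filter_inst

end Counting

end MultiExit

end ZoneZ

end PercRepro
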